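import Mathlib
import HarnessLib
import Literature.Analysis.FluidPDE.SwirlTransportProofs
import Summits.NavierStokesRegularity.NavierStokesRegularity.Theorems.LrcModEntire.Negative.ShiftField
import Summits.NavierStokesRegularity.NavierStokesRegularity.Theorems.PoloidalWindowRigidity.Negative.GermOffFourStrata

/-!
# Item `LrcModEntire` (stmt-NavierStokesRegularity-20428, route `PoloidalWindowDoor`; = the registered stub
# `stub_lrcModEntire` of crux K2 `PoloidalWindowRigidity`, skeleton lrc-jet v3) — negative side:
# the Oseen-mild identity is LOAD-BEARING, by a frozen poloidal witness with SPATIALLY VARYING shear slope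

Negative-side support (refuter seat ns-regularity-refuter1, cell ns-regularity-ideate; D-0081 §C). The item
`Summit.NavierStokesRegularity.NavierStokesRegularity.Theses.PoloidalWindowDoor.LrcModEntire` says: for a profile `v` of
the Type-I ancient mild class — (R) Type-I time rate, (C) continuity on the open backward slab, (M) the unit-viscosity
Oseen-mild identity between negative times, (D) divergence-free slices — which is (P) poloidal along `e₂` on every
slice, every non-empty open space–time set `W` of the slab carrying the non-degeneracy pins (`curl v ≠ 0`,
`∇ₕ v₂ ≠ 0`, `∂₂ vₕ ≠ 0`) on which the shear slope is NOT a function of time alone on any open subset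
(`∀ m : ℝ → ℝ`, every open `W₁ ⊆ W` has a point with `∂₂ v_b ≠ m(t) ∂_b v₂` for some horizontal `b`) forces a slice
`s < 0` and a window `U` on which EITHER the vorticity has an infinitesimal Killing symmetry (a translation germ
`D(curl v(s))[e] = 0`, `e ≠ 0`, or a rotation germ about a vertical axis through some `c`), OR `v(s)` agrees with an
entire real-analytic field of unbounded norm.

This file certifies, with the shifted cellular profile of `…Negative.ShiftField` (slope `μ(x₂) = −sin x₂/(sin x₂ + 3)`):

* `analyticOnNhd_shiftProfile`, `analyticOnNhd_curl_shiftProfile`, `analyticOnNhd_fderiv_curl_shiftProfile_apply`: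
  every slice, its vorticity and the directional derivatives of the vorticity are real-analytic on `ℝ³`;
* `shiftProfile_pins`: on the window `shiftWindow = {t < 0} × {cos x₀ > 0, 0 < x₂ < π/2}` all three pins hold;
  `shiftProfile_slope_not_time_only`: for every `m : ℝ → ℝ` and every non-empty open `W₁ ⊆ shiftWindow` some point of
  `W₁` has `∂₂v₀ ≠ m(t) ∂₀v₂` (the slope is strictly monotone in `x₂` on the window, `Real.strictMonoOn_sin`);
* `shiftProfile_no_translation_germ`, `shiftProfile_no_rotation_germ`, `shiftProfile_no_unbounded_entire_germ`: on no
  window of any slice `s < 0` does the vorticity have a translation germ or a vertical-axis rotation germ, and no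
  slice agrees on a window with an entire field of unbounded norm (identity theorem
  `…PoloidalWindowRigidity.Negative.eq_zero_of_eqOn_open` + three evaluation points, resp. boundedness);
* `lrcModEntire_false_without_mild`: the item's text VERBATIM with hypothesis (M) deleted is FALSE (`C = 10`).
  So (M) is load-bearing for `LrcModEntire` exactly as for K2 itself
  (`…PoloidalWindowRigidity.Negative.poloidalWindowRigidity_false_without_mild` and the residue-stub certificates of
  this lane), and sharper: Type-I rate + continuity + incompressibility + poloidality + the frozen constraint +
  proportional shear with `∇μ ≠ 0` do NOT force an infinitesimal Killing symmetry of the vorticity on any window — a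
  proof of the item must use the Navier–Stokes dynamics (through (M)) at full strength, as the ℚ-exact jet
  certificates of ns-poloidal-K2-cert-1 (N* = 12/13) do.

WHAT THIS IS NOT: not a claim about Navier–Stokes regularity and not a refutation of the item — a kernel-checked
certificate that hypothesis (M) of the item cannot be dropped (information for the K2 lead's line census).
-/

noncomputable section

-- the summit and its single sub-problem share the name (CONVENTIONS §1), as in every Theorems file
set_option linter.dupNamespace false

namespace Summit.NavierStokesRegularity.NavierStokesRegularity.Theorems.LrcModEntire.Negative

open MeasureTheory Set Function Filter Topology Metric
open scoped RealInnerProductSpace InnerProductSpace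
open Literature.Analysis Literature.Analysis.FluidPDE
open Summit.NavierStokesRegularity.NavierStokesRegularity.Theorems.PoloidalWindowRigidity.Negative

local notation "E3" => EuclideanSpace ℝ (Fin 3)
local notation "π" i => (EuclideanSpace.proj (𝕜 := ℝ) (i : Fin 3) : EuclideanSpace ℝ (Fin 3) →L[ℝ] ℝ)
local notation "𝐞" i => (EuclideanSpace.single (i : Fin 3) (1 : ℝ) : EuclideanSpace ℝ (Fin 3))

/-! ## Real-analyticity of the slices -/

/-- The coordinate functions are real-analytic. [folklore] -/
theorem analyticAt_coord (k : Fin 3) (x : E3) : AnalyticAt ℝ (fun x : E3 => x k) x :=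
  (EuclideanSpace.proj k : E3 →L[ℝ] ℝ).analyticAt x

/-- The profile slice in the standard basis. [folklore] -/
theorem shiftProfile_eq_sum (s : ℝ) (x : E3) : shiftProfile s x =
    (cellAmp s * (Real.cos (x 2) * Real.cos (x 0))) • (𝐞 0) +
      (cellAmp s * (Real.cos (x 2) * Real.cos (x 1))) • (𝐞 1) +
      (cellAmp s * ((Real.sin (x 2) + 3) * (Real.sin (x 0) + Real.sin (x 1)))) • (𝐞 2) := by
  ext i
  fin_cases i <;> simp [shiftProfile, shiftField_apply_zero, shiftField_apply_one, shiftField_apply_two]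

/-- **Every slice of the shifted cellular profile is real-analytic on `ℝ³`.** [folklore] -/
theorem analyticOnNhd_shiftProfile (s : ℝ) : AnalyticOnNhd ℝ (shiftProfile s) univ := by
  intro x _
  have hY := fun k => analyticAt_coord k x
  have e : shiftProfile s = fun x =>
      (cellAmp s * (Real.cos (x 2) * Real.cos (x 0))) • (𝐞 0) +
        (cellAmp s * (Real.cos (x 2) * Real.cos (x 1))) • (𝐞 1) +
        (cellAmp s * ((Real.sin (x 2) + 3) * (Real.sin (x 0) + Real.sin (x 1)))) • (𝐞 2) :=
    funext (shiftProfile_eq_sum s)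
  rw [e]
  refine ((analyticAt_const.mul ((Real.analyticAt_cos.comp (hY 2)).mul (Real.analyticAt_cos.comp (hY 0)))).smul
    analyticAt_const).add ((analyticAt_const.mul ((Real.analyticAt_cos.comp (hY 2)).mul
      (Real.analyticAt_cos.comp (hY 1)))).smul analyticAt_const) |>.add ?_
  exact (analyticAt_const.mul (((Real.analyticAt_sin.comp (hY 2)).add analyticAt_const).mul
    ((Real.analyticAt_sin.comp (hY 0)).add (Real.analyticAt_sin.comp (hY 1))))).smul analyticAt_const

/-- **The vorticity of every slice of the shifted cellular profile is real-analytic on `ℝ³`.** [folklore] -/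
theorem analyticOnNhd_curl_shiftProfile (s : ℝ) : AnalyticOnNhd ℝ (curl (shiftProfile s)) univ := by
  intro x _
  have hY := fun k => analyticAt_coord k x
  have e : curl (shiftProfile s) = fun x =>
      (cellAmp s * ((2 * Real.sin (x 2) + 3) * Real.cos (x 1))) • (𝐞 0) +
        (cellAmp s * (-((2 * Real.sin (x 2) + 3) * Real.cos (x 0)))) • (𝐞 1) := by
    funext x
    rw [curl_shiftProfile, vortField, smul_add, smul_smul, smul_smul]
  rw [e]
  have h2s : AnalyticAt ℝ (fun x : E3 => 2 * Real.sin (x 2) + 3) x :=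
    (analyticAt_const.mul (Real.analyticAt_sin.comp (hY 2))).add analyticAt_const
  refine ((analyticAt_const.mul (h2s.mul (Real.analyticAt_cos.comp (hY 1)))).smul analyticAt_const).add ?_
  exact (analyticAt_const.mul (h2s.mul (Real.analyticAt_cos.comp (hY 0))).neg).smul analyticAt_const

/-- **Every directional derivative of the vorticity of every slice is real-analytic on `ℝ³`.** [folklore] -/
theorem analyticOnNhd_fderiv_curl_shiftProfile_apply (s : ℝ) (e : E3) :
    AnalyticOnNhd ℝ (fun y => fderiv ℝ (curl (shiftProfile s)) y e) univ :=
  (ContinuousLinearMap.apply ℝ (EuclideanSpace ℝ (Fin 3)) e).comp_analyticOnNhd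
    (analyticOnNhd_curl_shiftProfile s).fderiv

/-! ## The window, the pins and the slope clause -/

/-- The space–time window `{t < 0} × {x | cos x₀ > 0, 0 < x₂ < π/2}`. [folklore] -/
def shiftWindow : Set (ℝ × E3) :=
  Set.Iio (0 : ℝ) ×ˢ {x : E3 | 0 < Real.cos (x 0) ∧ 0 < x 2 ∧ x 2 < Real.pi / 2}

/-- The window is open. [folklore] -/
theorem isOpen_shiftWindow : IsOpen shiftWindow := by
  refine isOpen_Iio.prod ?_
  have h0 : Continuous fun x : E3 => Real.cos (x 0) := by fun_prop
  have h2 : Continuous fun x : E3 => x 2 := by fun_prop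
  exact (isOpen_lt continuous_const h0).inter ((isOpen_lt continuous_const h2).inter (isOpen_lt h2 continuous_const))

/-- The window is non-empty: it contains `(−1, (0, 0, π/4))`. [folklore] -/
theorem shiftWindow_nonempty : shiftWindow.Nonempty := by
  refine ⟨((-1 : ℝ), (Real.pi / 4) • (𝐞 2)), ?_, ?_⟩
  · show (-1 : ℝ) < 0
    norm_num
  · show 0 < Real.cos (((Real.pi / 4) • (𝐞 2)) 0) ∧ 0 < ((Real.pi / 4) • (𝐞 2)) 2 ∧
      ((Real.pi / 4) • (𝐞 2)) 2 < Real.pi / 2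
    have a0 : ((Real.pi / 4) • (𝐞 2)) 0 = 0 := by simp
    have a2 : ((Real.pi / 4) • (𝐞 2)) 2 = Real.pi / 4 := by simp
    rw [a0, a2, Real.cos_zero]
    refine ⟨one_pos, ?_, ?_⟩ <;> linarith [Real.pi_pos]

/-- The window lies in the open backward slab. [folklore] -/
theorem shiftWindow_subset : shiftWindow ⊆ Set.Iio (0 : ℝ) ×ˢ Set.univ :=
  Set.prod_mono le_rfl (Set.subset_univ _)

/-- Membership in the window, unfolded. [folklore] -/
theorem mem_shiftWindow {z : ℝ × E3} (hz : z ∈ shiftWindow) :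
    z.1 < 0 ∧ 0 < Real.cos (z.2 0) ∧ 0 < z.2 2 ∧ z.2 2 < Real.pi / 2 := by
  simpa [shiftWindow, Set.mem_prod] using hz

/-- **The three non-degeneracy pins hold on the window**: `curl v ≠ 0`, `∂₀ v₂ ≠ 0`, `∂₂ v₀ ≠ 0`. [folklore] -/
theorem shiftProfile_pins (z : ℝ × E3) (hz : z ∈ shiftWindow) :
    curl (shiftProfile z.1) z.2 ≠ 0 ∧
      (fderiv ℝ (shiftProfile z.1) z.2 (𝐞 0) 2 ≠ 0 ∨ fderiv ℝ (shiftProfile z.1) z.2 (𝐞 1) 2 ≠ 0) ∧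
      (fderiv ℝ (shiftProfile z.1) z.2 (𝐞 2) 0 ≠ 0 ∨ fderiv ℝ (shiftProfile z.1) z.2 (𝐞 2) 1 ≠ 0) := by
  obtain ⟨ht, hcos, hx2, hx2'⟩ := mem_shiftWindow hz
  have hc := cellAmp_pos ht
  have hsin : 0 < Real.sin (z.2 2) := Real.sin_pos_of_pos_of_lt_pi hx2 (by linarith [Real.pi_pos])
  have h23 : 0 < 2 * Real.sin (z.2 2) + 3 := by linarith
  refine ⟨fun h0 => ?_, Or.inl ?_, Or.inl ?_⟩
  · have h1 := curl_shiftProfile_apply_one z.1 z.2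
    rw [h0, PiLp.zero_apply] at h1
    have : 0 < cellAmp z.1 * ((2 * Real.sin (z.2 2) + 3) * Real.cos (z.2 0)) := mul_pos hc (mul_pos h23 hcos)
    linarith
  · rw [fderiv_shiftProfile_e0_apply_two]
    exact (mul_pos hc (mul_pos (by linarith) hcos)).ne'
  · rw [fderiv_shiftProfile_e2_apply_zero]
    have : cellAmp z.1 * (-Real.sin (z.2 2) * Real.cos (z.2 0)) < 0 := by
      have := mul_pos hc (mul_pos hsin hcos)
      nlinarith
    exact this.ne

/-- **The slope clause holds on the window**: for every candidate time-only slope `m : ℝ → ℝ` and every non-empty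
open `W₁ ⊆ shiftWindow`, some point of `W₁` has `∂₂ v₀ ≠ m(t) ∂₀ v₂` — because `∂₂ v₀ / ∂₀ v₂ = −sin x₂/(sin x₂ + 3)`
is strictly monotone in `x₂ ∈ (0, π/2)` while `m(t)` is constant along the vertical segment through a point.
[folklore] -/
theorem shiftProfile_slope_not_time_only (m : ℝ → ℝ) (W₁ : Set (ℝ × E3)) (hW₁ : W₁ ⊆ shiftWindow)
    (hW₁o : IsOpen W₁) (hW₁n : W₁.Nonempty) :
    ∃ z ∈ W₁, ∃ b : Fin 3, b ≠ 2 ∧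
      fderiv ℝ (shiftProfile z.1) z.2 (𝐞 2) b ≠ m z.1 * fderiv ℝ (shiftProfile z.1) z.2 (𝐞 b) 2 := by
  by_contra hcon
  push Not at hcon
  obtain ⟨z, hz⟩ := hW₁n
  obtain ⟨ε, hε, hball⟩ := Metric.isOpen_iff.mp hW₁o z hz
  have key : ∀ w ∈ W₁, -Real.sin (w.2 2) = m w.1 * (Real.sin (w.2 2) + 3) := fun w hw => by
    have h := hcon w hw 0 (by decide)
    rw [fderiv_shiftProfile_e2_apply_zero, fderiv_shiftProfile_e0_apply_two] at h
    obtain ⟨hwt, hwcos, -, -⟩ := mem_shiftWindow (hW₁ hw)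
    have hK : cellAmp w.1 * Real.cos (w.2 0) ≠ 0 := (mul_pos (cellAmp_pos hwt) hwcos).ne'
    apply mul_left_cancel₀ hK
    linear_combination h
  have hmem : ((z.1, z.2 + (ε / 2) • (𝐞 2)) : ℝ × E3) ∈ W₁ := hball (by
    rw [Metric.mem_ball, Prod.dist_eq]
    have d1 : dist ((z.1, z.2 + (ε / 2) • (𝐞 2)) : ℝ × E3).1 z.1 = 0 := by simp
    have d2 : dist ((z.1, z.2 + (ε / 2) • (𝐞 2)) : ℝ × E3).2 z.2 = ε / 2 := by
      show dist (z.2 + (ε / 2) • (𝐞 2)) z.2 = ε / 2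
      rw [dist_eq_norm, add_sub_cancel_left, norm_smul, Real.norm_of_nonneg (half_pos hε).le]
      simp
    rw [d1, d2, max_eq_right (half_pos hε).le]
    exact half_lt_self hε)
  have h1 := key z hz
  have h2 := key _ hmem
  have e2 : ((z.1, z.2 + (ε / 2) • (𝐞 2)) : ℝ × E3).2 2 = z.2 2 + ε / 2 := by simp
  have e1 : ((z.1, z.2 + (ε / 2) • (𝐞 2)) : ℝ × E3).1 = z.1 := rfl
  rw [e1, e2] at h2
  obtain ⟨-, -, hx2, hx2'⟩ := mem_shiftWindow (hW₁ hz)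
  have hb := mem_shiftWindow (hW₁ hmem)
  rw [e2] at hb
  obtain ⟨-, -, hy2, hy2'⟩ := hb
  have hlt : Real.sin (z.2 2) < Real.sin (z.2 2 + ε / 2) :=
    Real.strictMonoOn_sin ⟨by linarith [Real.pi_pos], by linarith⟩ ⟨by linarith [Real.pi_pos], by linarith⟩
      (by linarith)
  have h3 : (m z.1 + 1) * (Real.sin (z.2 2) - Real.sin (z.2 2 + ε / 2)) = 0 := by linear_combination h2 - h1
  rcases mul_eq_zero.1 h3 with hM | hS
  · have hM' : m z.1 = -1 := by linarith
    rw [hM'] at h1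
    linarith
  · linarith

/-! ## No window of any slice carries a Killing germ or an unbounded entire germ -/

/-- **No translation germ**: on no non-empty open set of any slice `s < 0` does a directional derivative of the
vorticity in a fixed non-zero direction vanish (evaluate the entire extension at `0`, `(π/2) e₁`, `(π/2) e₀`).
[folklore] -/
theorem shiftProfile_no_translation_germ {s : ℝ} (hs : s < 0) {U : Set E3} (hU : IsOpen U) (hne : U.Nonempty)
    {e : E3} (he : e ≠ 0) (h : ∀ y ∈ U, fderiv ℝ (curl (shiftProfile s)) y e = 0) : False := by
  obtain ⟨y₀, hy₀⟩ := hne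
  have hglob := eq_zero_of_eqOn_open (analyticOnNhd_fderiv_curl_shiftProfile_apply s e) hU hy₀ h
  have hc := cellAmp_pos hs
  have p11 : ((Real.pi / 2) • (𝐞 1) : E3) 1 = Real.pi / 2 := by simp
  have p12 : ((Real.pi / 2) • (𝐞 1) : E3) 2 = 0 := by simp
  have p00 : ((Real.pi / 2) • (𝐞 0) : E3) 0 = Real.pi / 2 := by simp
  have p02 : ((Real.pi / 2) • (𝐞 0) : E3) 2 = 0 := by simp
  -- at `y = 0`: `2 (−s)^{-1/2} e₂ = 0`
  have h2 : e 2 = 0 := by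
    have h0 : fderiv ℝ (curl (shiftProfile s)) 0 e 0 = 0 := by rw [hglob 0, PiLp.zero_apply]
    rw [fderiv_curl_shiftProfile_apply_zero, PiLp.zero_apply, PiLp.zero_apply, Real.sin_zero, Real.cos_zero] at h0
    have : cellAmp s * (2 * e 2) = 0 := by linear_combination h0
    rcases mul_eq_zero.1 this with h' | h'
    · exact absurd h' hc.ne'
    · linarith
  -- at `y = (π/2) e₁`: `−3 (−s)^{-1/2} e₁ = 0`
  have h1 : e 1 = 0 := by
    have h0 : fderiv ℝ (curl (shiftProfile s)) ((Real.pi / 2) • (𝐞 1)) e 0 = 0 := by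
      rw [hglob _, PiLp.zero_apply]
    rw [fderiv_curl_shiftProfile_apply_zero, p11, p12, Real.sin_pi_div_two, Real.sin_zero, Real.cos_zero, h2] at h0
    have : cellAmp s * (-3 * e 1) = 0 := by linear_combination h0
    rcases mul_eq_zero.1 this with h' | h'
    · exact absurd h' hc.ne'
    · linarith
  -- at `y = (π/2) e₀`: `3 (−s)^{-1/2} e₀ = 0`
  have h0' : e 0 = 0 := by
    have h0 : fderiv ℝ (curl (shiftProfile s)) ((Real.pi / 2) • (𝐞 0)) e 1 = 0 := by
      rw [hglob _, PiLp.zero_apply]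
    rw [fderiv_curl_shiftProfile_apply_one, p00, p02, Real.sin_pi_div_two, Real.sin_zero, h2] at h0
    have : cellAmp s * (3 * e 0) = 0 := by linear_combination h0
    rcases mul_eq_zero.1 this with h' | h'
    · exact absurd h' hc.ne'
    · linarith
  apply he
  ext i
  fin_cases i
  · simpa using h0'
  · simpa using h1
  · simpa using h2

/-- **No rotation germ about a vertical axis**: on no non-empty open set of any slice `s < 0` does the vorticity
satisfy the infinitesimal Killing equation `J curl v(s)(y) = D(curl v(s))(y) J(y − c)` of the rotations about the
vertical axis through `c` (first component of the entire extension at `y = 0`: `3 (−s)^{-1/2} = 0`). [folklore] -/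
theorem shiftProfile_no_rotation_germ {s : ℝ} (hs : s < 0) {U : Set E3} (hU : IsOpen U) (hne : U.Nonempty)
    (c : E3) (h : ∀ y ∈ U, rotGen (curl (shiftProfile s) y) = fderiv ℝ (curl (shiftProfile s)) y (rotGen (y - c))) :
    False := by
  obtain ⟨y₀, hy₀⟩ := hne
  have hc := cellAmp_pos hs
  -- the first component of the Killing defect, written out: an entire function
  set φ : E3 → ℝ := fun y =>
    cellAmp s * (2 * Real.sin (y 2) + 3) * (Real.cos (y 0) + Real.sin (y 1) * (y 0 - c 0)) with hφ
  have hφa : AnalyticOnNhd ℝ φ univ := by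
    intro y _
    have hY := fun k => analyticAt_coord k y
    exact (analyticAt_const.mul ((analyticAt_const.mul (Real.analyticAt_sin.comp (hY 2))).add
      analyticAt_const)).mul ((Real.analyticAt_cos.comp (hY 0)).add ((Real.analyticAt_sin.comp (hY 1)).mul
        ((hY 0).sub analyticAt_const)))
  have hφU : ∀ y ∈ U, φ y = 0 := fun y hy => by
    have hy' := congrArg (fun w : E3 => w 0) (h y hy)
    dsimp only at hy'
    rw [rotGen_apply_zero, curl_shiftProfile_apply_one, fderiv_curl_shiftProfile_apply_zero, rotGen_apply_one,
      rotGen_apply_two, PiLp.sub_apply] at hy'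
    rw [hφ]
    linear_combination hy'
  have h0 := eq_zero_of_eqOn_open hφa hU hy₀ hφU 0
  rw [hφ] at h0
  dsimp only at h0
  rw [PiLp.zero_apply, PiLp.zero_apply, PiLp.zero_apply, Real.sin_zero, Real.cos_zero] at h0
  have : cellAmp s * 3 = 0 := by linear_combination h0
  rcases mul_eq_zero.1 this with h' | h'
  · exact hc.ne' h'
  · norm_num at h'

/-- **No unbounded entire germ**: an entire real-analytic field agreeing with a slice of the witness on a non-empty
open set is the slice itself, hence bounded (`‖v(s)‖ ≤ 10 (−s)^{-1/2}`). [folklore] -/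
theorem shiftProfile_no_unbounded_entire_germ (s : ℝ) {U : Set E3} (hU : IsOpen U) (hne : U.Nonempty)
    {w : E3 → E3} (hw : AnalyticOnNhd ℝ w univ) (hwU : ∀ y ∈ U, shiftProfile s y = w y) :
    BddAbove (Set.range fun y => ‖w y‖) := by
  obtain ⟨y₀, hy₀⟩ := hne
  have hglob := eq_zero_of_eqOn_open (hw.sub (analyticOnNhd_shiftProfile s)) hU hy₀
    (fun y hy => by simp [hwU y hy])
  refine ⟨cellAmp s * 10, ?_⟩
  rintro _ ⟨y, rfl⟩
  have hy : w y = shiftProfile s y := by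
    have h := hglob y
    simp only [Pi.sub_apply, sub_eq_zero] at h
    exact h
  show ‖w y‖ ≤ cellAmp s * 10
  rw [hy]
  exact norm_shiftProfile_le s y

/-! ## The item minus the Oseen-mild identity is false -/

/-- **`LrcModEntire` without the Oseen-mild identity is FALSE.** The negated statement is the text of
`Summit.NavierStokesRegularity.NavierStokesRegularity.Theses.PoloidalWindowDoor.LrcModEntire` (item
stmt-NavierStokesRegularity-20428 = stub `stub_lrcModEntire` of skeleton lrc-jet v3 of crux 19708) VERBATIM with its
third hypothesis (the unit-viscosity Oseen-mild identity `v t x = heatExtension (v s) (t − s) x − oseenDuhamel 1 s v v t x`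
for `s < t < 0`) deleted. Witness: the shifted cellular Type-I profile
`v(t, x) = (−t)^{-1/2} (cos x₂ cos x₀, cos x₂ cos x₁, (sin x₂ + 3)(sin x₀ + sin x₁))` (`C = 10`) on the window
`{t < 0} × {cos x₀ > 0, 0 < x₂ < π/2}`: it has (R), (C), (D), is poloidal along `e₂` (and frozen), carries the three
pins on the window, its shear slope `−sin x₂/(sin x₂ + 3)` is not time-only on any open subset, and no slice has a
vorticity translation germ, a vertical-axis rotation germ, or an unbounded entire germ on any window. Hence the
Oseen-mild identity (M) is load-bearing for the item, and the slope clause `∇Λ ≠ 0` together with the frozen poloidal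
kinematics and the Type-I rate forces no Killing symmetry of the vorticity. [folklore] -/
theorem lrcModEntire_false_without_mild :
    ¬ (∀ (C : ℝ) (v : ℝ → EuclideanSpace ℝ (Fin 3) → EuclideanSpace ℝ (Fin 3)),
        HasTypeITimeDecay C v →
        ContinuousOn (Function.uncurry v) (Set.Iio (0 : ℝ) ×ˢ Set.univ) →
        (∀ t < 0, VectorCalculus.IsDivFree (v t)) →
        (∀ s < 0, ∀ y, ⟪curl (v s) y, EuclideanSpace.single 2 1⟫_ℝ = 0) →
        ∀ W : Set (ℝ × EuclideanSpace ℝ (Fin 3)), IsOpen W → W.Nonempty → W ⊆ Set.Iio (0 : ℝ) ×ˢ Set.univ →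
        (∀ z ∈ W, curl (v z.1) z.2 ≠ 0 ∧
          (fderiv ℝ (v z.1) z.2 (EuclideanSpace.single 0 1) 2 ≠ 0 ∨
            fderiv ℝ (v z.1) z.2 (EuclideanSpace.single 1 1) 2 ≠ 0) ∧
          (fderiv ℝ (v z.1) z.2 (EuclideanSpace.single 2 1) 0 ≠ 0 ∨
            fderiv ℝ (v z.1) z.2 (EuclideanSpace.single 2 1) 1 ≠ 0)) →
        (∀ m : ℝ → ℝ, ∀ W₁ : Set (ℝ × EuclideanSpace ℝ (Fin 3)), W₁ ⊆ W → IsOpen W₁ → W₁.Nonempty →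
          ∃ z ∈ W₁, ∃ b : Fin 3, b ≠ 2 ∧
            fderiv ℝ (v z.1) z.2 (EuclideanSpace.single 2 1) b ≠
              m z.1 * fderiv ℝ (v z.1) z.2 (EuclideanSpace.single b 1) 2) →
        ∃ s : ℝ, s < 0 ∧ ∃ U : Set (EuclideanSpace ℝ (Fin 3)), IsOpen U ∧ U.Nonempty ∧
          ((∃ e : EuclideanSpace ℝ (Fin 3), e ≠ 0 ∧ ∀ y ∈ U, fderiv ℝ (curl (v s)) y e = 0) ∨
           (∃ c : EuclideanSpace ℝ (Fin 3), ∀ y ∈ U,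
              rotGen (curl (v s) y) = fderiv ℝ (curl (v s)) y (rotGen (y - c))) ∨
           (∃ w : EuclideanSpace ℝ (Fin 3) → EuclideanSpace ℝ (Fin 3), AnalyticOnNhd ℝ w Set.univ ∧
              ¬ BddAbove (Set.range fun y => ‖w y‖) ∧ ∀ y ∈ U, v s y = w y))) := by
  intro H
  obtain ⟨s, hs, U, hU, hne, halt⟩ := H 10 shiftProfile hasTypeITimeDecay_shiftProfile continuousOn_shiftProfile
    (fun t _ => isDivFree_shiftProfile t) (fun s _ y => poloidal_shiftProfile s y) shiftWindow isOpen_shiftWindow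
    shiftWindow_nonempty shiftWindow_subset shiftProfile_pins
    (fun m W₁ hW₁ hW₁o hW₁n => shiftProfile_slope_not_time_only m W₁ hW₁ hW₁o hW₁n)
  rcases halt with ⟨e, he, htr⟩ | ⟨c, hrot⟩ | ⟨w, hw, hunb, hwU⟩
  · exact shiftProfile_no_translation_germ hs hU hne he htr
  · exact shiftProfile_no_rotation_germ hs hU hne c hrot
  · exact hunb (shiftProfile_no_unbounded_entire_germ s hU hne hw hwU)

end Summit.NavierStokesRegularity.NavierStokesRegularity.Theorems.LrcModEntire.Negative

end
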